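/-
Copyright (c) 2026 the pub-hodgecm-mathlib formalisation cell (harness21).  Prover seat hodgecm-mathlib-K2Liu-p14 (g3), Track B «K2-LIT»,
#184♮ = hLiu418 = `stmt-HodgeConjecture-24832`; Road I v3, S5-F3 lineage ∕ I4-conv (F′-fact), CAPSTONE (γ): term 2 is the Siegel Eisenstein series of a factorizable line section.
-/
import Summits.HodgeConjecture.HodgeConjecture.Theorems.K2LiuKlingenInnerSectionFactorizableLineOfRecord   -- ★ OF-RECORD: `exists_factorizable_line_ofRecord`
import Summits.HodgeConjecture.HodgeConjecture.Theorems.K2LiuKlingenTermTwoTransport                       -- ★ carrier (A): §4 `exists_const_eisensteinSeriesU_innerSectionOrbit_eq`, `isSiegelDeltaSection_innerSection_comp_bridgeOver_symm`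
import Summits.HodgeConjecture.HodgeConjecture.Theorems.K2LiuKlingenInnerSectionIntegrable               -- ★ (xi) (K2Liu-p05): `integrable_innerSectionOrbit` ((A)'s `hint`), `integrable_innerSection_termTwo` (E-final's `hFi`) on `1 < re s`
import HarnessLib

/-!
# Crux `HLiu418`, I4-conv (F′-fact), CAPSTONE (γ) — `K2LiuKlingenTermTwoFactorizableSection`:
# TERM 2 OF THE KLINGEN CONSTANT TERM IS A CONSTANT TIMES THE SIEGEL EISENSTEIN SERIES OF A FACTORIZABLE LINE SECTION

Cell `hodgecm-mathlib`, crux item hLiu418 = `stmt-HodgeConjecture-24832`; squad K2 ∕ K2Liu; LEAD F0P6-plan (g14) BATCH #36∕#56∕#62 (I4-conv organ, U1 E-lineage =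
K2Liu-p14 (g3)).  THEOREMS ONLY (no `def`, no instance, no notation, no named-fact hypothesis, no `sorry`); lane `--supports stmt-HodgeConjecture-24832 --as helper`
(count-neutral).

THE POINT.  Two ★ results of the U1 E-lineage are composed into the input shape of Road Φ's ★ Φ3d `whittakerDelta_eq_mul_tprod_euler` at `n := 1` (I4 proper: the
Fourier coefficients of term 2 as Euler products; K2Liu-p12's ★ `K2LiuKlingenTermTwoFourierAdapter` transfers through the constant):
* ★ carrier (A) `K2LiuKlingenTermTwoTransport.exists_const_eisensteinSeriesU_innerSectionOrbit_eq` — for F10's term-2 orbit section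
  `F_h(y) = ∫ β₁(u) • f_s(Ψ(ξ^L)·u·Ψ(m_Q^𝔸(1, j₂⁻¹y))·h) dνN(u)` and ONE constant `C ≠ ∞` (all `h`, `g₂`): `E_B(F_h)(g₂) = C · E^Δ_{n=1}(F′_h ∘ Ψ_S⁻¹)(Ψ_S g₂)`,
  `F′_h(y) = ∫_{Y(𝔸)×𝔸_L} f_s(Ψ(ξ)Ψ(n_Q(y,0,t))Ψ(m_Q(1,j₂⁻¹y))h) d(μ_Y ⊗ μ_T)` the inner section, `Ψ_S = adelicUnitaryGroupCongr L S J₁^𝔻 J₂ hc` the line bridge of record;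
* ★ OF-RECORD `K2LiuKlingenInnerSectionFactorizableLineOfRecord.exists_factorizable_line_ofRecord` — `∃ g gT′, IsFactorizableOff¹ T′ χ g gT′ ∧ ∀ s g₂, (integrable) →
  F′_{h,f_s}(g₂) = g (s − ½) (Ψ_S g₂)`.
§1 **`exists_factorizable_line_section`** (the family-level core, no constant): for the family `f` (★ #31s-factorizable off `T′`), `h` integral off `T′`:
`∃ g gT′, IsFactorizableOff¹ T′ χ g gT′ ∧ ∀ s, (∀ g₂, term-2 integrand at (s,g₂) integrable) → (F′_{h,f_s} ∘ Ψ_S⁻¹ = g (s − ½)  — AS FUNCTIONS on H₁(𝔸)) ∧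
(f_s ∈ I_Δ(s, χ) continuous → g (s − ½) ∈ I_Δ,line(s − ½, χ))` (★ OF-RECORD at `g₂ := Ψ_S⁻¹ x`; the section law by ★ (A) `isSiegelDeltaSection_innerSection_comp_bridgeOver_symm`).
ONE family `g` serves every `s` (the `T′`-part `gT′` varies with `s`, the local factors are the normalised spherical `Λ¹_{s,v}`), which is what a continuation in `s` needs.
§2 **`exists_const_factorizable_eisensteinSeriesU_eq`** (THE CAPSTONE ON THE CONVERGENCE HALF-PLANE `1 < re s`, `χ` unitary, `f_s ∈ I_Δ(s, χ)` continuous, `dV, dW ≠ 0`; all of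
★ (A) §4's letters except `hint` + the OF-RECORD side letters): `∃ C ≠ ∞, ∀ h (integral off T′), ∃ g gT′, IsFactorizableOff¹ T′ χ g gT′ ∧ g (s − ½) ∈ I_Δ,line(s − ½, χ) ∧
∀ g₂, E_B(F_h)(g₂) = C · E^Δ_{n=1}(g (s − ½))(Ψ_S g₂)` — `C` is ★ (A)'s constant (one for all `h`, `g₂`); NO integrability binder: ★ (A)'s `hint` is ★ (xi)
`K2LiuKlingenInnerSectionIntegrable.integrable_innerSectionOrbit` and §1's per-`g₂` integrability is ★ (xi) `integrable_innerSection_termTwo` (K2Liu-p05 (g7)).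
BY-VALUE INPUTS left for the I4 tie: ★ (A) §4's structural letters (`νN`, the weights `β₁`, `β₀`, the lattice `Γ₁`, the F3′ transport clauses `hΨ ha hSA hSAi hXY hYX hΨP`),
the OF-RECORD side letters (`T′`-conditions `h2 h2w hδv hν1 hSint hχ hh`, `hfac`), and `f_s ∈ I_Δ(s,χ)` continuous.
[MoeglinWaldspurger1995, II.1.5, II.1.7], [Tan1999, §1–§2], [Liu2011, §2B p. 862, §2C (2-4)], [GanTakeda2011SiegelWeil, §7.2 p. 23], [CasselsFrohlichANT1967, Ch. XV §3.3 Thm. 3.3.1].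
HONEST LABEL.  Count-neutral helper, closes no socket: `HC_CM` is proved only modulo the 7 printed citations (2 remaining named inputs: hLiu418 =
`stmt-HodgeConjecture-24832`, h413 = `stmt-HodgeConjecture-24833`) until rung 0 closes.
-/

set_option autoImplicit false
set_option linter.dupNamespace false -- the mandated namespace repeats `HodgeConjecture.HodgeConjecture`

noncomputable section

open scoped Matrix ENNReal NNReal Topology
open NumberField IsDedekindDomain MeasureTheory Measure Filter Set

namespace Summit.HodgeConjecture.HodgeConjecture.Cruxes.HLiu418.K2LiuKlingenTermTwoFactorizableSection

open Literature.MeasureTheory.Group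
open Literature.NumberTheory.Automorphic Literature.NumberTheory.Automorphic.UnitaryGroup
open Literature.NumberTheory.GelbartRogawski1991 Literature.NumberTheory.GelbartRogawski1991.GRConstruction
open Literature.NumberTheory.GaloisRepresentations
open Literature.NumberTheory.K2Lit.SiegelDoubled Literature.NumberTheory.K2Lit.LocalSiegelDoubled
open Summit.HodgeConjecture.HodgeConjecture.Cruxes.H413.K2E1BorelEisensteinU (eisensteinSeriesU)
open Summit.HodgeConjecture.HodgeConjecture.Cruxes.HLiu418.K2LiuDoubledUTwoTwoBorelFrame Summit.HodgeConjecture.HodgeConjecture.Cruxes.HLiu418.K2LiuKlingenParabolicDefs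
open Summit.HodgeConjecture.HodgeConjecture.Cruxes.HLiu418.K2LiuKlingenUnipotentDefs Summit.HodgeConjecture.HodgeConjecture.Cruxes.HLiu418.K2LiuKlingenUnipotentAdelicDefs
open Summit.HodgeConjecture.HodgeConjecture.Cruxes.HLiu418.K2LiuSiegelDoubledLeviMatrix (conjAdele_conjAdele')
open Summit.HodgeConjecture.HodgeConjecture.Cruxes.HLiu418.K2LiuKlingenInnerSectionLocalDefs
open Summit.HodgeConjecture.HodgeConjecture.Cruxes.HLiu418.K2LiuKlingenTermTwoTransport
  (exists_const_eisensteinSeriesU_innerSectionOrbit_eq isSiegelDeltaSection_innerSection_comp_bridgeOver_symm)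
open Summit.HodgeConjecture.HodgeConjecture.Cruxes.HLiu418.K2LiuKlingenInnerSectionFactorizableLineOfRecord (exists_factorizable_line_ofRecord)
open Summit.HodgeConjecture.HodgeConjecture.Cruxes.HLiu418.K2LiuKlingenInnerSectionIntegrable (integrable_innerSectionOrbit integrable_innerSection_termTwo)
open UnitaryDualPair

variable (L : Type) [Field L] [NumberField L] [IsCMField L]

section Capstone

variable {N M : ℕ} {e : Fin N × Fin M ≃ Fin 2}
  {dV : Fin N → L} {hdV : ∀ i, IsCMField.complexConj L (dV i) = dV i}
  {dW : Fin M → L} {hdW : ∀ i, IsCMField.complexConj L (dW i) = dW i}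

/-! ## §1 The family-level core: `F′_h ∘ Ψ_S⁻¹ = g (s − ½)`, `g` factorizable off `T′` and a Siegel line section -/

/-- **`F′_{h,f_s} ∘ Ψ_S⁻¹ = g (s − ½)` AS FUNCTIONS ON `H₁(𝔸)`, for ONE ★ #31s-factorizable line family `g` serving every `s`** (statement in the header): ★ OF-RECORD
`exists_factorizable_line_ofRecord` evaluated at `g₂ := Ψ_S⁻¹ x` under the integrability of the term-2 integrand at every `g₂`, and — when `f_s` is a continuous Siegel
section of `I_Δ(s, χ)` — the section law of `I_Δ,line(s − ½, χ)` for `g (s − ½)` transferred along this equality from ★ (A) `isSiegelDeltaSection_innerSection_comp_bridgeOver_symm`.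
Binders: ★ OF-RECORD's, plus `[SecondCountableTopology 𝔸_L]`, `[SFinite μY] [SFinite μT]` and the F3′ clause `hΨP` that ★ (A) needs.
[cite: MoeglinWaldspurger1995, II.1.7] [cite: Tan1999, §1] [cite: Liu2011, §2B p. 862] [cite: CasselsFrohlichANT1967, Ch. XV (Tate) §3.3 Thm. 3.3.1] -/
theorem exists_factorizable_line_section
    [MeasurableSpace (AdeleRing (𝓞 L) L)] [BorelSpace (AdeleRing (𝓞 L) L)] [SecondCountableTopology (AdeleRing (𝓞 L) L)]
    [MeasurableSpace (InfiniteAdeleRing (Fp L))] [BorelSpace (InfiniteAdeleRing (Fp L))]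
    [∀ v : HeightOneSpectrum (𝓞 (Fp L)), MeasurableSpace (v.adicCompletion (Fp L))] [∀ v : HeightOneSpectrum (𝓞 (Fp L)), BorelSpace (v.adicCompletion (Fp L))]
    [∀ v : HeightOneSpectrum (𝓞 (Fp L)), MeasurableSpace (LocalRing L v)] [∀ v : HeightOneSpectrum (𝓞 (Fp L)), BorelSpace (LocalRing L v)]
    {δ : L} (hσδ : IsCMField.complexConj L δ = -δ) (hδ : δ ≠ 0)
    (Y : AddSubgroup (AdeleRing (𝓞 L) L)) (hY : ∀ y, y ∈ Y ↔ conjAdele (Fp L) L (IsCMField.complexConj L) y = -y)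
    (μY : Measure ↥Y) (μT : Measure (AdeleRing (𝓞 L) L)) [SFinite μY] [SFinite μT] [μY.IsAddHaarMeasure] [μT.IsAddHaarMeasure]
    (T' : Finset (HeightOneSpectrum (𝓞 (Fp L))))
    (νY : ∀ v : HeightOneSpectrum (𝓞 (Fp L)), Measure ↥(skewLoc L v)) (νT : ∀ v : HeightOneSpectrum (𝓞 (Fp L)), Measure (LocalRing L v))
    [∀ v, SFinite (νY v)] [∀ v, (νY v).IsAddLeftInvariant] [∀ v, SFinite (νT v)] [∀ v, (νT v).IsAddHaarMeasure]
    [∀ v, ((νY v).prod (νT v)).IsAddHaarMeasure]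
    (h2 : ∀ v, v ∉ T' → Valued.v ((2 : Fp L) : v.adicCompletion (Fp L)) = 1)
    (h2w : ∀ v, v ∉ T' → ∀ w : PlacesOver L v, ValuativeRel.valuation (w.1.adicCompletion L) (2 : w.1.adicCompletion L) = 1)
    (hδv : ∀ v, v ∉ T' → ∀ w : PlacesOver L v, Valued.v (algebraMap L (w.1.adicCompletion L) δ) = 1)
    (hν1 : ∀ v, v ∉ T' → ((νY v).prod (νT v))
      {q : ↥(skewLoc L v) × LocalRing L v | (∀ w : PlacesOver L v, (q.1 : LocalRing L v) w ∈ w.1.adicCompletionIntegers L) ∧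
        ∀ w : PlacesOver L v, q.2 w ∈ w.1.adicCompletionIntegers L} = 1)
    -- the F-files' transport, pinned (★ carrier (A) `K2LiuKlingenTermTwoTransport` §4 binders verbatim)
    {SA : GL (Fin (2 + 2)) (AdeleRing (𝓞 L) L)} (Ψ : (quasiSplit (Fp L) L (IsCMField.complexConj L) (2 + 2)).Adelic ≃ₜ* HA L e dV hdV dW hdW)
    {X Y' : Matrix (Fin 2) (Fin 2) (Fp L)} {a : Fp L}
    (hΨ : ∀ g : (quasiSplit (Fp L) L (IsCMField.complexConj L) (2 + 2)).Adelic,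
      (((Ψ g : HA L e dV hdV dW hdW) : GL (Fin (2 + 2)) (AdeleRing (𝓞 L) L)) : Matrix (Fin (2 + 2)) (Fin (2 + 2)) (AdeleRing (𝓞 L) L)) =
        (SA : Matrix (Fin (2 + 2)) (Fin (2 + 2)) (AdeleRing (𝓞 L) L)) *
          ((adelicVal (Fp L) L (IsCMField.complexConj L) (2 + 2) _ g : GL (Fin (2 + 2)) (AdeleRing (𝓞 L) L)) :
            Matrix (Fin (2 + 2)) (Fin (2 + 2)) (AdeleRing (𝓞 L) L)) *
          ((SA⁻¹ : GL (Fin (2 + 2)) (AdeleRing (𝓞 L) L)) : Matrix (Fin (2 + 2)) (Fin (2 + 2)) (AdeleRing (𝓞 L) L)))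
    (ha : a + a = 1)
    (hSA : Matrix.reindex (e₂ (n := 2)).symm (e₂ (n := 2)).symm (SA : Matrix (Fin (2 + 2)) (Fin (2 + 2)) (AdeleRing (𝓞 L) L)) =
      Matrix.fromBlocks (1 : Matrix (Fin 2) (Fin 2) (AdeleRing (𝓞 L) L)) (X.map ((algebraMap L (AdeleRing (𝓞 L) L)).comp (algebraMap (Fp L) L))) 1
        (-(X.map ((algebraMap L (AdeleRing (𝓞 L) L)).comp (algebraMap (Fp L) L)))))
    (hSAi : Matrix.reindex (e₂ (n := 2)).symm (e₂ (n := 2)).symm ((SA⁻¹ : GL (Fin (2 + 2)) (AdeleRing (𝓞 L) L)) : Matrix (Fin (2 + 2)) (Fin (2 + 2)) (AdeleRing (𝓞 L) L)) =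
      Matrix.fromBlocks ((a • (1 : Matrix (Fin 2) (Fin 2) (Fp L))).map ((algebraMap L (AdeleRing (𝓞 L) L)).comp (algebraMap (Fp L) L)))
        ((a • (1 : Matrix (Fin 2) (Fin 2) (Fp L))).map ((algebraMap L (AdeleRing (𝓞 L) L)).comp (algebraMap (Fp L) L)))
        (Y'.map ((algebraMap L (AdeleRing (𝓞 L) L)).comp (algebraMap (Fp L) L)))
        (-(Y'.map ((algebraMap L (AdeleRing (𝓞 L) L)).comp (algebraMap (Fp L) L)))))
    (hΨP : ∀ b : (quasiSplit (Fp L) L (IsCMField.complexConj L) (2 + 2)).Adelic,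
      ((adelicVal (Fp L) L (IsCMField.complexConj L) (2 + 2) _ b : GL (Fin (2 + 2)) (AdeleRing (𝓞 L) L)) :
          Matrix (Fin (2 + 2)) (Fin (2 + 2)) (AdeleRing (𝓞 L) L)).BlockTriangular id →
        IsSiegelDelta L e dV hdV dW hdW (Ψ b))
    (hSint : ∀ v, v ∉ T' → ∀ w : PlacesOver L v, GLn.evalAt (2 + 2) L w.1 (GLn.sndHom (2 + 2) L SA) ∈ glInt (2 + 2) (w.1.adicCompletion L))
    (χ : HeckeCharacter L) (hχ : ∀ v, v ∉ T' → ∀ w : PlacesOver L v, χ.IsUnramifiedAt w.1)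
    (f : ℂ → HA L e dV hdV dW hdW → ℂ)
    (fT : ℂ → arch (Fp L) L (IsCMField.complexConj L) (2 + 2) (hermD L e dV hdV dW hdW) ×
      (Π v : T', localPi L (IsCMField.complexConj L) (2 + 2) (hermD L e dV hdV dW hdW) v.1) → ℂ)
    (hfac : IsFactorizableOff L e dV hdV dW hdW T' χ f fT) (h : HA L e dV hdV dW hdW)
    (hh : ∀ v, v ∉ T' → evalPlace (Fp L) L (IsCMField.complexConj L) (2 + 2) (hermD L e dV hdV dW hdW) v
      (finPart (Fp L) L (IsCMField.complexConj L) (2 + 2) (hermD L e dV hdV dW hdW) h) ∈ localInt L (IsCMField.complexConj L) (2 + 2) (hermD L e dV hdV dW hdW) v)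
    -- the line bridge OF RECORD `Ψ_S := adelicUnitaryGroupCongr L S J₁^𝔻 J₂ hc` (★ carrier (A) §3; `hc` = ★ `bridge_congr_over L S hS`)
    (S : GL (Fin 2) L) (hS : (S : Matrix (Fin 2) (Fin 2) L) = !![1, 2⁻¹; 1, -2⁻¹]) (hS' : ((S⁻¹ : GL (Fin 2) L) : Matrix (Fin 2) (Fin 2) L) = !![2⁻¹, 2⁻¹; 1, -1])
    (hc : ((S : Matrix (Fin 2) (Fin 2) L).map (cmConjRingHom L))ᵀ *
        hermD L (Equiv.prodUnique (Fin 1) (Fin 1)) (fun _ => (1 : L)) (fun _ => map_one _) (fun _ => (1 : L)) (fun _ => map_one _) * (S : Matrix (Fin 2) (Fin 2) L) =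
      (StdForm.antidiagonal 2).over L) :
    haveI : Algebra.IsQuadraticExtension (Fp L) L := IsCMField.isQuadraticExtension L
    ∃ (g : ℂ → HA L (Equiv.prodUnique (Fin 1) (Fin 1)) (fun _ => (1 : L)) (fun _ => map_one _) (fun _ => (1 : L)) (fun _ => map_one _) → ℂ)
      (gT' : ℂ → arch (Fp L) L (IsCMField.complexConj L) (1 + 1)
          (hermD L (Equiv.prodUnique (Fin 1) (Fin 1)) (fun _ => (1 : L)) (fun _ => map_one _) (fun _ => (1 : L)) (fun _ => map_one _)) ×
        (Π v : T', localPi L (IsCMField.complexConj L) (1 + 1)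
          (hermD L (Equiv.prodUnique (Fin 1) (Fin 1)) (fun _ => (1 : L)) (fun _ => map_one _) (fun _ => (1 : L)) (fun _ => map_one _)) v.1) → ℂ),
      IsFactorizableOff L (Equiv.prodUnique (Fin 1) (Fin 1)) (fun _ => (1 : L)) (fun _ => map_one _) (fun _ => (1 : L)) (fun _ => map_one _) T' χ g gT' ∧
      ∀ s : ℂ, (∀ g₂ : (quasiSplit (Fp L) L (IsCMField.complexConj L) 2).Adelic,
          Integrable (fun q : ↥Y × AdeleRing (𝓞 L) L =>
          f s (Ψ (jAdelic L 4 (weylXi (AdeleRing (𝓞 L) L) (conjAdele (Fp L) L (IsCMField.complexConj L)))) *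
            Ψ (jAdelic L 4 (nKlingen (AdeleRing (𝓞 L) L) (conjAdele (Fp L) L (IsCMField.complexConj L)) (conjAdele_conjAdele' L)
              (((q.1 : ↥Y) : AdeleRing (𝓞 L) L)) ((hY _).1 q.1.2) 0 q.2)) *
            (Ψ (jAdelic L 4 (klingenLevi (AdeleRing (𝓞 L) L) (conjAdele (Fp L) L (IsCMField.complexConj L)) (conjAdele_conjAdele' L) 1 ((jAdelic L 2).symm g₂))) * h))) (μY.prod μT)) →
        (fun x : HA L (Equiv.prodUnique (Fin 1) (Fin 1)) (fun _ => (1 : L)) (fun _ => map_one _) (fun _ => (1 : L)) (fun _ => map_one _) =>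
            (fun y : (quasiSplit (Fp L) L (IsCMField.complexConj L) 2).Adelic =>
              ∫ q : ↥Y × AdeleRing (𝓞 L) L,
          f s (Ψ (jAdelic L 4 (weylXi (AdeleRing (𝓞 L) L) (conjAdele (Fp L) L (IsCMField.complexConj L)))) *
            Ψ (jAdelic L 4 (nKlingen (AdeleRing (𝓞 L) L) (conjAdele (Fp L) L (IsCMField.complexConj L)) (conjAdele_conjAdele' L)
              (((q.1 : ↥Y) : AdeleRing (𝓞 L) L)) ((hY _).1 q.1.2) 0 q.2)) *
            (Ψ (jAdelic L 4 (klingenLevi (AdeleRing (𝓞 L) L) (conjAdele (Fp L) L (IsCMField.complexConj L)) (conjAdele_conjAdele' L) 1 ((jAdelic L 2).symm y))) * h)) ∂(μY.prod μT))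
              ((adelicUnitaryGroupCongr L S _ _ hc).symm x)) = g (s - 1 / 2) ∧
        (IsSiegelDeltaSection L e dV hdV dW hdW χ s (f s) → Continuous (f s) →
          IsSiegelDeltaSection L (Equiv.prodUnique (Fin 1) (Fin 1)) (fun _ => (1 : L)) (fun _ => map_one _) (fun _ => (1 : L)) (fun _ => map_one _) χ (s - 1 / 2) (g (s - 1 / 2))) := by
  haveI : Algebra.IsQuadraticExtension (Fp L) L := IsCMField.isQuadraticExtension L
  obtain ⟨g, gT', hfac', hE⟩ := exists_factorizable_line_ofRecord L hσδ hδ Y hY μY μT T' νY νT h2 h2w hδv hν1 Ψ hΨ ha hSA hSAi hSint χ hχ f fT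
    hfac h hh S hS hS' hc
  refine ⟨g, gT', hfac', fun s hFi => ?_⟩
  -- `F′_{h,f_s} ∘ Ψ_S⁻¹ = g (s − ½)` pointwise: ★ OF-RECORD at `g₂ := Ψ_S⁻¹ x`
  have hfun : (fun x : HA L (Equiv.prodUnique (Fin 1) (Fin 1)) (fun _ => (1 : L)) (fun _ => map_one _) (fun _ => (1 : L)) (fun _ => map_one _) =>
            (fun y : (quasiSplit (Fp L) L (IsCMField.complexConj L) 2).Adelic =>
              ∫ q : ↥Y × AdeleRing (𝓞 L) L,
          f s (Ψ (jAdelic L 4 (weylXi (AdeleRing (𝓞 L) L) (conjAdele (Fp L) L (IsCMField.complexConj L)))) *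
            Ψ (jAdelic L 4 (nKlingen (AdeleRing (𝓞 L) L) (conjAdele (Fp L) L (IsCMField.complexConj L)) (conjAdele_conjAdele' L)
              (((q.1 : ↥Y) : AdeleRing (𝓞 L) L)) ((hY _).1 q.1.2) 0 q.2)) *
            (Ψ (jAdelic L 4 (klingenLevi (AdeleRing (𝓞 L) L) (conjAdele (Fp L) L (IsCMField.complexConj L)) (conjAdele_conjAdele' L) 1 ((jAdelic L 2).symm y))) * h)) ∂(μY.prod μT))
              ((adelicUnitaryGroupCongr L S _ _ hc).symm x)) = g (s - 1 / 2) := by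
    funext x
    have key := hE s ((adelicUnitaryGroupCongr L S _ _ hc).symm x) (hFi _)
    rwa [ContinuousMulEquiv.apply_symm_apply] at key
  refine ⟨hfun, fun hf hfc => ?_⟩
  -- the section law of `I_Δ,line(s − ½, χ)` transfers from ★ (A) `isSiegelDeltaSection_innerSection_comp_bridgeOver_symm`
  rw [← hfun]
  exact isSiegelDeltaSection_innerSection_comp_bridgeOver_symm hΨ ha hSA hSAi hΨP Y hY μY μT hf hfc h S hS hS' hc

/-! ## §2 THE CAPSTONE: `T₂ = C · E^Δ_{n=1}(g (s − ½))(Ψ_S g₂)` -/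

/-- **TERM 2 IS A CONSTANT TIMES THE SIEGEL EISENSTEIN SERIES OF A FACTORIZABLE LINE SECTION, on `1 < re s`** (statement in the header): ★ carrier (A) §4
`exists_const_eisensteinSeriesU_innerSectionOrbit_eq` (its constant `C ≠ ∞`, one for all `h`, `g₂`; its `hint` binder PAID by ★ (xi) `integrable_innerSectionOrbit`) composed with
§1 (`E^Δ(F′_h ∘ Ψ_S⁻¹) = E^Δ(g (s − ½))` by the function equality; §1's per-`g₂` integrability PAID by ★ (xi) `integrable_innerSection_termTwo`).  Binders: ★ (A) §4's VERBATIM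
minus `hint` (`νN`, `μZ μY μT`, `Γ₁ hΓ₁`, `β₁ hβ₁`, `β₀ hβ₀m hβ₀ hβ₀fin`, `hf hfc` at `f := f s`, the F3′ clauses `hΨ ha hSA hSAi hXY hYX hΨP`, `S hS hS' hc`), ★ OF-RECORD's
(`T′`-letters, `hfac`), `dV dW ≠ 0`, `χ` unitary, `1 < re s`; per `h` only its integrality off `T′`.
[cite: MoeglinWaldspurger1995, II.1.5, II.1.7] [cite: Tan1999, §1] [cite: GanTakeda2011SiegelWeil, §7.2 p. 23] [cite: Liu2011, §2C (2-4)] -/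
theorem exists_const_factorizable_eisensteinSeriesU_eq
    [MeasurableSpace (AdeleRing (𝓞 L) L)] [BorelSpace (AdeleRing (𝓞 L) L)] [SecondCountableTopology (AdeleRing (𝓞 L) L)]
    [MeasurableSpace (InfiniteAdeleRing (Fp L))] [BorelSpace (InfiniteAdeleRing (Fp L))]
    [∀ v : HeightOneSpectrum (𝓞 (Fp L)), MeasurableSpace (v.adicCompletion (Fp L))] [∀ v : HeightOneSpectrum (𝓞 (Fp L)), BorelSpace (v.adicCompletion (Fp L))]
    [∀ v : HeightOneSpectrum (𝓞 (Fp L)), MeasurableSpace (LocalRing L v)] [∀ v : HeightOneSpectrum (𝓞 (Fp L)), BorelSpace (LocalRing L v)]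
    {δ : L} (hσδ : IsCMField.complexConj L δ = -δ) (hδ : δ ≠ 0)
    (Y : AddSubgroup (AdeleRing (𝓞 L) L)) (hY : ∀ y, y ∈ Y ↔ conjAdele (Fp L) L (IsCMField.complexConj L) y = -y)
    (μZ : Measure (AdeleRing (𝓞 L) L)) (μY : Measure ↥Y) (μT : Measure (AdeleRing (𝓞 L) L)) [SFinite μZ] [SFinite μY] [SFinite μT]
    [μZ.IsAddHaarMeasure] [μY.IsAddHaarMeasure] [μT.IsAddHaarMeasure]
    (T' : Finset (HeightOneSpectrum (𝓞 (Fp L))))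
    (νY : ∀ v : HeightOneSpectrum (𝓞 (Fp L)), Measure ↥(skewLoc L v)) (νT : ∀ v : HeightOneSpectrum (𝓞 (Fp L)), Measure (LocalRing L v))
    [∀ v, SFinite (νY v)] [∀ v, (νY v).IsAddLeftInvariant] [∀ v, SFinite (νT v)] [∀ v, (νT v).IsAddHaarMeasure]
    [∀ v, ((νY v).prod (νT v)).IsAddHaarMeasure]
    (h2 : ∀ v, v ∉ T' → Valued.v ((2 : Fp L) : v.adicCompletion (Fp L)) = 1)
    (h2w : ∀ v, v ∉ T' → ∀ w : PlacesOver L v, ValuativeRel.valuation (w.1.adicCompletion L) (2 : w.1.adicCompletion L) = 1)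
    (hδv : ∀ v, v ∉ T' → ∀ w : PlacesOver L v, Valued.v (algebraMap L (w.1.adicCompletion L) δ) = 1)
    (hν1 : ∀ v, v ∉ T' → ((νY v).prod (νT v))
      {q : ↥(skewLoc L v) × LocalRing L v | (∀ w : PlacesOver L v, (q.1 : LocalRing L v) w ∈ w.1.adicCompletionIntegers L) ∧
        ∀ w : PlacesOver L v, q.2 w ∈ w.1.adicCompletionIntegers L} = 1)
    -- the F-files' transport, pinned (★ carrier (A) `K2LiuKlingenTermTwoTransport` §4 binders verbatim)
    {SA : GL (Fin (2 + 2)) (AdeleRing (𝓞 L) L)} (Ψ : (quasiSplit (Fp L) L (IsCMField.complexConj L) (2 + 2)).Adelic ≃ₜ* HA L e dV hdV dW hdW)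
    {X Y' : Matrix (Fin 2) (Fin 2) (Fp L)} {a : Fp L}
    (hΨ : ∀ g : (quasiSplit (Fp L) L (IsCMField.complexConj L) (2 + 2)).Adelic,
      (((Ψ g : HA L e dV hdV dW hdW) : GL (Fin (2 + 2)) (AdeleRing (𝓞 L) L)) : Matrix (Fin (2 + 2)) (Fin (2 + 2)) (AdeleRing (𝓞 L) L)) =
        (SA : Matrix (Fin (2 + 2)) (Fin (2 + 2)) (AdeleRing (𝓞 L) L)) *
          ((adelicVal (Fp L) L (IsCMField.complexConj L) (2 + 2) _ g : GL (Fin (2 + 2)) (AdeleRing (𝓞 L) L)) :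
            Matrix (Fin (2 + 2)) (Fin (2 + 2)) (AdeleRing (𝓞 L) L)) *
          ((SA⁻¹ : GL (Fin (2 + 2)) (AdeleRing (𝓞 L) L)) : Matrix (Fin (2 + 2)) (Fin (2 + 2)) (AdeleRing (𝓞 L) L)))
    (ha : a + a = 1)
    (hSA : Matrix.reindex (e₂ (n := 2)).symm (e₂ (n := 2)).symm (SA : Matrix (Fin (2 + 2)) (Fin (2 + 2)) (AdeleRing (𝓞 L) L)) =
      Matrix.fromBlocks (1 : Matrix (Fin 2) (Fin 2) (AdeleRing (𝓞 L) L)) (X.map ((algebraMap L (AdeleRing (𝓞 L) L)).comp (algebraMap (Fp L) L))) 1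
        (-(X.map ((algebraMap L (AdeleRing (𝓞 L) L)).comp (algebraMap (Fp L) L)))))
    (hSAi : Matrix.reindex (e₂ (n := 2)).symm (e₂ (n := 2)).symm ((SA⁻¹ : GL (Fin (2 + 2)) (AdeleRing (𝓞 L) L)) : Matrix (Fin (2 + 2)) (Fin (2 + 2)) (AdeleRing (𝓞 L) L)) =
      Matrix.fromBlocks ((a • (1 : Matrix (Fin 2) (Fin 2) (Fp L))).map ((algebraMap L (AdeleRing (𝓞 L) L)).comp (algebraMap (Fp L) L)))
        ((a • (1 : Matrix (Fin 2) (Fin 2) (Fp L))).map ((algebraMap L (AdeleRing (𝓞 L) L)).comp (algebraMap (Fp L) L)))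
        (Y'.map ((algebraMap L (AdeleRing (𝓞 L) L)).comp (algebraMap (Fp L) L)))
        (-(Y'.map ((algebraMap L (AdeleRing (𝓞 L) L)).comp (algebraMap (Fp L) L)))))
    (hXY : X * Y' = a • (1 : Matrix (Fin 2) (Fin 2) (Fp L))) (hYX : Y' * X = a • (1 : Matrix (Fin 2) (Fin 2) (Fp L)))
    (hΨP : ∀ b : (quasiSplit (Fp L) L (IsCMField.complexConj L) (2 + 2)).Adelic,
      ((adelicVal (Fp L) L (IsCMField.complexConj L) (2 + 2) _ b : GL (Fin (2 + 2)) (AdeleRing (𝓞 L) L)) :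
          Matrix (Fin (2 + 2)) (Fin (2 + 2)) (AdeleRing (𝓞 L) L)).BlockTriangular id →
        IsSiegelDelta L e dV hdV dW hdW (Ψ b))
    [MeasurableSpace ↥(klingenUnipA Ψ)] [BorelSpace ↥(klingenUnipA Ψ)] [LocallyCompactSpace ↥(klingenUnipA Ψ)] [SecondCountableTopology ↥(klingenUnipA Ψ)]
    (νN : Measure ↥(klingenUnipA Ψ)) [νN.IsHaarMeasure]
    (Γ₁ : Subgroup ↥(klingenUnipA Ψ))
    (hΓ₁ : ∀ u : ↥(klingenUnipA Ψ), u ∈ Γ₁ ↔ (u : HA L e dV hdV dW hdW) ∈ ratH L e dV hdV dW hdW ∧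
      IsSiegelDelta L e dV hdV dW hdW (Ψ (UnitaryGroup.toAdelic (Fp L) L (IsCMField.complexConj L) (2 + 2) ((StdForm.antidiagonal (2 + 2)).over L) (weylXi L ((IsCMField.complexConj L : L ≃ₐ[Fp L] L) : L →+* L))) * (u : HA L e dV hdV dW hdW) * (Ψ (UnitaryGroup.toAdelic (Fp L) L (IsCMField.complexConj L) (2 + 2) ((StdForm.antidiagonal (2 + 2)).over L) (weylXi L ((IsCMField.complexConj L : L ≃ₐ[Fp L] L) : L →+* L))))⁻¹))
    {β₁ : ↥(klingenUnipA Ψ) → ℝ≥0∞} (hβ₁ : IsCoveringWeight ↥Γ₁ β₁)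
    {β₀ : AdeleRing (𝓞 L) L → ℝ≥0∞} (hβ₀m : Measurable β₀) (hβ₀ : ∀ z, ∑' l : ↥((algebraMap L (AdeleRing (𝓞 L) L)).toAddMonoidHom.range), β₀ ((l : AdeleRing (𝓞 L) L) + z) = 1)
    (hβ₀fin : ∫⁻ z, β₀ z ∂μZ ≠ ∞)
    (hSint : ∀ v, v ∉ T' → ∀ w : PlacesOver L v, GLn.evalAt (2 + 2) L w.1 (GLn.sndHom (2 + 2) L SA) ∈ glInt (2 + 2) (w.1.adicCompletion L))
    (χ : HeckeCharacter L) (hχ : ∀ v, v ∉ T' → ∀ w : PlacesOver L v, χ.IsUnramifiedAt w.1)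
    (f : ℂ → HA L e dV hdV dW hdW → ℂ)
    (fT : ℂ → arch (Fp L) L (IsCMField.complexConj L) (2 + 2) (hermD L e dV hdV dW hdW) ×
      (Π v : T', localPi L (IsCMField.complexConj L) (2 + 2) (hermD L e dV hdV dW hdW) v.1) → ℂ)
    (hfac : IsFactorizableOff L e dV hdV dW hdW T' χ f fT) {s : ℂ}
    (hf : IsSiegelDeltaSection L e dV hdV dW hdW χ s (f s)) (hfc : Continuous (f s))
    (hdV0 : ∀ i, dV i ≠ 0) (hdW0 : ∀ i, dW i ≠ 0) (hχu : χ.IsUnitary) (hs : 1 < s.re)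
    -- the line bridge OF RECORD `Ψ_S := adelicUnitaryGroupCongr L S J₁^𝔻 J₂ hc` (★ carrier (A) §3; `hc` = ★ `bridge_congr_over L S hS`)
    (S : GL (Fin 2) L) (hS : (S : Matrix (Fin 2) (Fin 2) L) = !![1, 2⁻¹; 1, -2⁻¹]) (hS' : ((S⁻¹ : GL (Fin 2) L) : Matrix (Fin 2) (Fin 2) L) = !![2⁻¹, 2⁻¹; 1, -1])
    (hc : ((S : Matrix (Fin 2) (Fin 2) L).map (cmConjRingHom L))ᵀ *
        hermD L (Equiv.prodUnique (Fin 1) (Fin 1)) (fun _ => (1 : L)) (fun _ => map_one _) (fun _ => (1 : L)) (fun _ => map_one _) * (S : Matrix (Fin 2) (Fin 2) L) =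
      (StdForm.antidiagonal 2).over L) :
    haveI : Algebra.IsQuadraticExtension (Fp L) L := IsCMField.isQuadraticExtension L
    ∃ C : ℝ≥0∞, C ≠ ∞ ∧ ∀ h : HA L e dV hdV dW hdW,
      (∀ v, v ∉ T' → evalPlace (Fp L) L (IsCMField.complexConj L) (2 + 2) (hermD L e dV hdV dW hdW) v (finPart (Fp L) L (IsCMField.complexConj L) (2 + 2) (hermD L e dV hdV dW hdW) h) ∈ localInt L (IsCMField.complexConj L) (2 + 2) (hermD L e dV hdV dW hdW) v) →
      ∃ (g : ℂ → HA L (Equiv.prodUnique (Fin 1) (Fin 1)) (fun _ => (1 : L)) (fun _ => map_one _) (fun _ => (1 : L)) (fun _ => map_one _) → ℂ)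
        (gT' : ℂ → arch (Fp L) L (IsCMField.complexConj L) (1 + 1)
            (hermD L (Equiv.prodUnique (Fin 1) (Fin 1)) (fun _ => (1 : L)) (fun _ => map_one _) (fun _ => (1 : L)) (fun _ => map_one _)) ×
          (Π v : T', localPi L (IsCMField.complexConj L) (1 + 1)
            (hermD L (Equiv.prodUnique (Fin 1) (Fin 1)) (fun _ => (1 : L)) (fun _ => map_one _) (fun _ => (1 : L)) (fun _ => map_one _)) v.1) → ℂ),
        IsFactorizableOff L (Equiv.prodUnique (Fin 1) (Fin 1)) (fun _ => (1 : L)) (fun _ => map_one _) (fun _ => (1 : L)) (fun _ => map_one _) T' χ g gT' ∧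
          IsSiegelDeltaSection L (Equiv.prodUnique (Fin 1) (Fin 1)) (fun _ => (1 : L)) (fun _ => map_one _) (fun _ => (1 : L)) (fun _ => map_one _) χ (s - 1 / 2) (g (s - 1 / 2)) ∧
          ∀ g₂ : (quasiSplit (Fp L) L (IsCMField.complexConj L) 2).Adelic,
            eisensteinSeriesU (fun y : (quasiSplit (Fp L) L (IsCMField.complexConj L) 2).Adelic =>
                ∫ u, (β₁ u).toReal • f s (Ψ (UnitaryGroup.toAdelic (Fp L) L (IsCMField.complexConj L) (2 + 2) ((StdForm.antidiagonal (2 + 2)).over L) (weylXi L ((IsCMField.complexConj L : L ≃ₐ[Fp L] L) : L →+* L))) * (u : HA L e dV hdV dW hdW) *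
                  (Ψ (jAdelic L 4 (klingenLevi (AdeleRing (𝓞 L) L) (conjAdele (Fp L) L (IsCMField.complexConj L)) (conjAdele_conjAdele' L) 1 ((jAdelic L 2).symm y))) * h)) ∂νN) g₂ =
              C.toReal * eisensteinSeriesDelta L (Equiv.prodUnique (Fin 1) (Fin 1)) (fun _ => (1 : L)) (fun _ => map_one _) (fun _ => (1 : L)) (fun _ => map_one _) (g (s - 1 / 2))
                (adelicUnitaryGroupCongr L S _ _ hc g₂) := by
  haveI : Algebra.IsQuadraticExtension (Fp L) L := IsCMField.isQuadraticExtension L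
  -- ★ (A) §4: `T₂ = C · E^Δ_{n=1}(F′_h ∘ Ψ_S⁻¹)(Ψ_S g₂)`, ONE `C ≠ ∞` for all `h`, `g₂`; its `hint` is ★ (xi) §2 on `1 < re s`
  obtain ⟨C, hCtop, hA⟩ := exists_const_eisensteinSeriesU_innerSectionOrbit_eq hΨ ha hSA hSAi hXY hYX hΨP νN Y hY μZ μY μT Γ₁ hΓ₁ hβ₁
    hβ₀m hβ₀ hβ₀fin hf hfc (integrable_innerSectionOrbit hΨ ha hSA hSAi hXY hYX hdV0 hdW0 νN Γ₁ hΓ₁ hβ₁ hχu hs hf hfc) S hS hS' hc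
  refine ⟨C, hCtop, fun h hh => ?_⟩
  -- §1: `F′_h ∘ Ψ_S⁻¹ = g (s − ½)` with `g` factorizable off `T′` and a section of `I_Δ,line(s − ½, χ)`
  obtain ⟨g, gT', hfac', hg⟩ := exists_factorizable_line_section L hσδ hδ Y hY μY μT T' νY νT h2 h2w hδv hν1 Ψ hΨ ha hSA hSAi hΨP hSint χ hχ
    f fT hfac h hh S hS hS' hc
  -- ★ (xi) §4: the term-2 integrand is integrable at every `g₂` on `1 < re s`
  obtain ⟨hfun, hsec⟩ := hg s (integrable_innerSection_termTwo hΨ ha hSA hSAi hXY hYX hΨP hdV0 hdW0 Y hY μY μT hχu f s hs hf hfc h)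
  exact ⟨g, gT', hfac', hsec hf hfc, fun g₂ => (hA h g₂).trans (by rw [hfun])⟩

end Capstone

end Summit.HodgeConjecture.HodgeConjecture.Cruxes.HLiu418.K2LiuKlingenTermTwoFactorizableSection

end
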